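/-
Copyright (c) 2026. All rights reserved.
Released under Apache 2.0 license as described in the file LICENSE.
Authors: abc-iut cell, wave-6 cone prover seat abc-iut-w6-d025 (gen 5; row «ARC-MTC-F3b-INPUT», L4-lead m140 (4)), over
abc-iut-L4-t3's `TBPlus` (`PanalocalTheaters.lean`) and abc-iut-w4-d095's `TBPlusCategory.lean`; consumer abc-iut-w5-d038
(row «ARC-MTC-F3», the archimedean `η⊢`).
-/
import Literature.AnabelianGeometry.AbsoluteAnabelian.TBPlusCategory
import Mathlib.Topology.Algebra.Group.Basic
import Mathlib.Topology.Homeomorph.Lemmas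
import Mathlib.CategoryTheory.Functor.Basic
import HarnessLib

/-!
# [AbsTopIII] Def 5.6 (i): universe lift for the category `TB⊞`

S. Mochizuki, *Topics in absolute anabelian geometry III*, J. Math. Sci. Univ. Tokyo 22 (2015) [MochizukiAbsTopIII2015];
manuscript `paper:url-5493eb38cbb7`, Def 5.6 (i) p. 134 l. 26–34: the category `TB⊞` of "two-dimensional connected
topological Lie groups `B` equipped with two one-parameter subgroups `B′, B″ ⊆ B` … together with an isomorphism
`β : Lie±(B′) ⥲ Lie±(B″)`", morphisms "the surjective homomorphisms `B₁ → B₂` of topological groups that are compatible with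
the `B′ᵢ, B″ᵢ, βᵢ`".

## What this file builds (bookkeeping only; the `TB⊞` twin of `TMMono.ulift`)

Print's `TB⊞` has no universe; the tree's `TBPlus.{u}` (abc-iut-L4-t3) carries its group `B : Type u`.  The archimedean
`η⊢_{v,ν}` of [AbsTopIII] Cor 5.10 (iv)(c) (abc-iut-w5-d038's row «ARC-MTC-F3») compares two functors that land in `TB⊞` at
DIFFERENT universes — abc-iut-L4-t8's `TB⊞`-leg `HolTHPlusPair.toTBPlus : HolTHPlusPair 𝔄 ⥤ TBPlus.{u}` (Def 5.6 (iv)) and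
the setting's `𝒩⊢⊞_v`-component `TMMono.kTilde : TMMono.{u+1} ⥤ TBPlus.{u+1}` — so a universe-lift functor is needed to
state it.  This file supplies exactly that and nothing else:

* `TBPlus.upHom B : B →ₜ+ ULift B`, `TBPlus.downHom B : ULift B →ₜ+ B` — `ULift.up` / `ULift.down` as continuous
  homomorphisms;
* `TBPlus.uliftObj M : TBPlus.{max u v}` — the SAME object with its group lifted: `B := ULift M.B`, `c₁, c₂ := up ∘ cᵢ`,
  `β := M.β`; the five axioms transported along the homeomorphic group isomorphism `ULift M.B ≃ M.B`;
* `TBPlus.uliftHom f` and ★ `TBPlus.uliftFunctor : TBPlus.{u} ⥤ TBPlus.{max u v}` — a morphism keeps its rescalings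
  `a₁, a₂` and has homomorphism `up ∘ f ∘ down`; `rfl` bookkeeping lemmas (`uliftObj_B`, `uliftObj_c₁_apply`,
  `uliftObj_c₂_apply`, `uliftObj_β`, `uliftFunctor_obj`, `uliftFunctor_map_toHom_apply`, `uliftFunctor_map_a₁`,
  `uliftFunctor_map_a₂`), and `uliftFunctor` is faithful (`uliftFunctor_map_injective`).

No new mathematical object, no named fact, no instance, no notation; the frozen `PanalocalTheaters.lean` / `TBPlusCategory.lean`
are imported, not edited.  Refereed pre-IUT material (a definition); MODEL-LEVEL bookkeeping; nothing here bears on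
[IUTchIII] Cor. 3.12; no side taken; typed ≠ proved.
-/

set_option autoImplicit false

universe v u

open CategoryTheory

namespace Literature.AnabelianGeometry.AbsoluteAnabelian

namespace TBPlus

/-! ## `ULift.up` / `ULift.down` as continuous homomorphisms -/

/-- `ULift.up : B → ULift B` as a continuous additive homomorphism. [cite: MochizukiAbsTopIII2015, Def 5.6 (i) p. 134] -/
def upHom (B : Type u) [AddCommGroup B] [TopologicalSpace B] : B →ₜ+ ULift.{v} B where
  toFun := ULift.up
  map_zero' := rfl
  map_add' _ _ := rfl
  continuous_toFun := continuous_uliftUp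

/-- `ULift.down : ULift B → B` as a continuous additive homomorphism. [cite: MochizukiAbsTopIII2015, Def 5.6 (i) p. 134] -/
def downHom (B : Type u) [AddCommGroup B] [TopologicalSpace B] : ULift.{v} B →ₜ+ B where
  toFun := ULift.down
  map_zero' := rfl
  map_add' _ _ := rfl
  continuous_toFun := continuous_uliftDown

/-- `upHom` applied. [cite: MochizukiAbsTopIII2015, Def 5.6 (i) p. 134] -/
@[simp] theorem upHom_apply (B : Type u) [AddCommGroup B] [TopologicalSpace B] (x : B) :
    upHom.{v} B x = ULift.up x := rfl

/-- `downHom` applied. [cite: MochizukiAbsTopIII2015, Def 5.6 (i) p. 134] -/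
@[simp] theorem downHom_apply (B : Type u) [AddCommGroup B] [TopologicalSpace B] (x : ULift.{v} B) :
    downHom.{v} B x = x.down := rfl

/-! ## The lifted object -/

variable (M : TBPlus.{u})

/-- **The same object of `TB⊞` with its group lifted to a larger universe**: `(ULift B, up ∘ c₁, up ∘ c₂, β)`; the axioms of
Def 5.6 (i) (genuine one-parameter subgroups, `B′ ∩ B″ = {0}`, `B′ × B″ → B` surjective and open, `β > 0`) are transported
along the homeomorphic isomorphism `ULift B ≃ B`. [cite: MochizukiAbsTopIII2015, Def 5.6 (i) p. 134] -/
def uliftObj : TBPlus.{max u v} where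
  B := ULift.{v} M.B
  topGrp := { }
  c₁ := (upHom.{v} M.B).comp M.c₁
  c₂ := (upHom.{v} M.B).comp M.c₂
  exists_injOn := by
    obtain ⟨ε, hε, h₁, h₂⟩ := M.exists_injOn
    exact ⟨ε, hε, fun s hs t ht hst => h₁ hs ht (ULift.up_inj.mp hst), fun s hs t ht hst => h₂ hs ht (ULift.up_inj.mp hst)⟩
  add_injective s t hst := by
    have h := M.add_injective s t (ULift.up_inj.mp hst)
    change ULift.up (M.c₁ s) = ULift.up 0
    rw [h]
  add_surjective := by
    rintro ⟨x⟩
    obtain ⟨p, hp⟩ := M.add_surjective x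
    exact ⟨p, congrArg ULift.up hp⟩
  isOpenMap_add := by
    have h : (fun p : ℝ × ℝ => (upHom.{v} M.B).comp M.c₁ p.1 + (upHom.{v} M.B).comp M.c₂ p.2) =
        Homeomorph.ulift.{v}.symm ∘ fun p : ℝ × ℝ => M.c₁ p.1 + M.c₂ p.2 := rfl
    rw [h]
    exact Homeomorph.ulift.symm.isOpenMap.comp M.isOpenMap_add
  β := M.β
  β_pos := M.β_pos

/-- The lifted group is `ULift B`. [cite: MochizukiAbsTopIII2015, Def 5.6 (i) p. 134] -/
theorem uliftObj_B : (uliftObj.{v} M).B = ULift.{v} M.B := rfl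

/-- The lifted `B′`-parametrisation is `up ∘ c₁`. [cite: MochizukiAbsTopIII2015, Def 5.6 (i) p. 134] -/
@[simp] theorem uliftObj_c₁_apply (s : ℝ) : (uliftObj.{v} M).c₁ s = ULift.up (M.c₁ s) := rfl

/-- The lifted `B″`-parametrisation is `up ∘ c₂`. [cite: MochizukiAbsTopIII2015, Def 5.6 (i) p. 134] -/
@[simp] theorem uliftObj_c₂_apply (s : ℝ) : (uliftObj.{v} M).c₂ s = ULift.up (M.c₂ s) := rfl

/-- The germ scalar `β` is unchanged. [cite: MochizukiAbsTopIII2015, Def 5.6 (i) p. 134] -/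
@[simp] theorem uliftObj_β : (uliftObj.{v} M).β = M.β := rfl

/-! ## The lift on morphisms and the functor -/

variable {M} {M₁ M₂ M₃ : TBPlus.{u}}

/-- **A morphism of `TB⊞` lifted**: homomorphism `up ∘ f ∘ down`, the SAME rescalings `a₁, a₂` (so the compatibilities with
`B′, B″, β` are those of `f`). [cite: MochizukiAbsTopIII2015, Def 5.6 (i) p. 134] -/
def uliftHom (f : M₁ ⟶ M₂) : uliftObj.{v} M₁ ⟶ uliftObj.{v} M₂ where
  toHom := (upHom.{v} M₂.B).comp (f.toHom.comp (downHom.{v} M₁.B))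
  surjective := by
    rintro ⟨y⟩
    obtain ⟨x, hx⟩ := f.surjective y
    exact ⟨ULift.up x, congrArg ULift.up hx⟩
  a₁ := f.a₁
  a₂ := f.a₂
  map_c₁ s := by
    change ULift.up (f.toHom (M₁.c₁ s)) = ULift.up (M₂.c₁ (f.a₁ * s))
    rw [f.map_c₁]
  map_c₂ s := by
    change ULift.up (f.toHom (M₁.c₂ s)) = ULift.up (M₂.c₂ (f.a₂ * s))
    rw [f.map_c₂]
  map_β := f.map_β

/-- The lifted homomorphism applied: `up (f x.down)`. [cite: MochizukiAbsTopIII2015, Def 5.6 (i) p. 134] -/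
@[simp] theorem uliftHom_toHom_apply (f : M₁ ⟶ M₂) (x : ULift.{v} M₁.B) :
    (uliftHom.{v} f).toHom x = ULift.up (f.toHom x.down) := rfl

/-- The lift keeps the `B′`-rescaling. [cite: MochizukiAbsTopIII2015, Def 5.6 (i) p. 134] -/
@[simp] theorem uliftHom_a₁ (f : M₁ ⟶ M₂) : (uliftHom.{v} f).a₁ = f.a₁ := rfl

/-- The lift keeps the `B″`-rescaling. [cite: MochizukiAbsTopIII2015, Def 5.6 (i) p. 134] -/
@[simp] theorem uliftHom_a₂ (f : M₁ ⟶ M₂) : (uliftHom.{v} f).a₂ = f.a₂ := rfl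

/-- The lift of the identity is the identity. [cite: MochizukiAbsTopIII2015, Def 5.6 (i) p. 134] -/
theorem uliftHom_id (M : TBPlus.{u}) : uliftHom.{v} (𝟙 M) = 𝟙 (uliftObj.{v} M) :=
  Hom.ext (by ext x; rfl) rfl rfl

/-- The lift of a composite is the composite of the lifts. [cite: MochizukiAbsTopIII2015, Def 5.6 (i) p. 134] -/
theorem uliftHom_comp (f : M₁ ⟶ M₂) (g : M₂ ⟶ M₃) :
    uliftHom.{v} (f ≫ g) = uliftHom.{v} f ≫ uliftHom.{v} g :=
  Hom.ext (by ext x; rfl) rfl rfl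

/-- ★ **The universe-lift functor `TB⊞ ⥤ TB⊞`**: `M ↦ (ULift B, up ∘ c₁, up ∘ c₂, β)`, `f ↦ up ∘ f ∘ down` with the same
rescalings. [cite: MochizukiAbsTopIII2015, Def 5.6 (i) p. 134] -/
def uliftFunctor : TBPlus.{u} ⥤ TBPlus.{max u v} where
  obj M := uliftObj.{v} M
  map f := uliftHom.{v} f
  map_id M := uliftHom_id.{v} M
  map_comp f g := uliftHom_comp.{v} f g

/-- On objects the functor is `uliftObj`. [cite: MochizukiAbsTopIII2015, Def 5.6 (i) p. 134] -/
theorem uliftFunctor_obj (M : TBPlus.{u}) : uliftFunctor.{v}.obj M = uliftObj.{v} M := rfl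

/-- On morphisms the functor is `uliftHom`. [cite: MochizukiAbsTopIII2015, Def 5.6 (i) p. 134] -/
theorem uliftFunctor_map (f : M₁ ⟶ M₂) : uliftFunctor.{v}.map f = uliftHom.{v} f := rfl

/-- The functor on morphisms, applied: `up (f x.down)`. [cite: MochizukiAbsTopIII2015, Def 5.6 (i) p. 134] -/
@[simp] theorem uliftFunctor_map_toHom_apply (f : M₁ ⟶ M₂) (x : ULift.{v} M₁.B) :
    (uliftFunctor.{v}.map f).toHom x = ULift.up (f.toHom x.down) := rfl

/-- The functor keeps the `B′`-rescaling of a morphism. [cite: MochizukiAbsTopIII2015, Def 5.6 (i) p. 134] -/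
@[simp] theorem uliftFunctor_map_a₁ (f : M₁ ⟶ M₂) : (uliftFunctor.{v}.map f).a₁ = f.a₁ := rfl

/-- The functor keeps the `B″`-rescaling of a morphism. [cite: MochizukiAbsTopIII2015, Def 5.6 (i) p. 134] -/
@[simp] theorem uliftFunctor_map_a₂ (f : M₁ ⟶ M₂) : (uliftFunctor.{v}.map f).a₂ = f.a₂ := rfl

/-- The homomorphism of a morphism is recovered from its lift: `f x = (down ∘ F(f) ∘ up) x`.
[cite: MochizukiAbsTopIII2015, Def 5.6 (i) p. 134] -/
theorem toHom_apply_eq_down_uliftFunctor_map (f : M₁ ⟶ M₂) (x : M₁.B) :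
    f.toHom x = ((uliftFunctor.{v}.map f).toHom (ULift.up x)).down := rfl

/-- **The universe-lift functor is faithful** (a morphism of `TB⊞` is determined by its homomorphism, abc-iut-w4-d095's
`hom_ext_toHom`, and the homomorphism is recovered from the lift). [cite: MochizukiAbsTopIII2015, Def 5.6 (i) p. 134] -/
theorem uliftFunctor_map_injective : Function.Injective (uliftFunctor.{v}.map : (M₁ ⟶ M₂) → _) := by
  intro f g h
  refine hom_ext_toHom ?_
  ext x
  rw [toHom_apply_eq_down_uliftFunctor_map.{v} f x, toHom_apply_eq_down_uliftFunctor_map.{v} g x, h]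

/-- A morphism INTO a lifted object from a lifted object with prescribed underlying homomorphism: the lift of `f` is the
unique morphism `F(M₁) → F(M₂)` whose homomorphism is `up ∘ f ∘ down` (by `hom_ext_toHom`).
[cite: MochizukiAbsTopIII2015, Def 5.6 (i) p. 134] -/
theorem eq_uliftFunctor_map_of_toHom_eq (f : M₁ ⟶ M₂) (g : uliftFunctor.{v}.obj M₁ ⟶ uliftFunctor.{v}.obj M₂)
    (h : ∀ x : ULift.{v} M₁.B, g.toHom x = ULift.up (f.toHom x.down)) : g = uliftFunctor.{v}.map f :=
  hom_ext_toHom (ContinuousAddMonoidHom.ext h)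

end TBPlus

end Literature.AnabelianGeometry.AbsoluteAnabelian
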